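import Mathlib
import Summits.KontsevichZagierPeriods.KontsevichZagierPeriods.Theorems.SoloInformedTorsionChain
import HarnessLib
import HarnessLib.Audit

/-!
# The inversion move `u = ((1−t)/(1+t))²` and the cycle relation W14 (solo-informed, s23)

THEOREM XI (KERNEL). A NEW ONE-VARIABLE MOVE FAMILY for Kontsevich–Zagier's calculus: for every
rational `a`, the single algebraic change of variables `u = ((1 − t)/(1 + t))²` — the quotient
of `(0,1) ∪ (1,∞)` by the involution `t ↦ 1/t` of `ℙ¹ ∖ {0,1,∞}`, restricted to its fundamental
domain `(0,1)` — carries `4^a · t^{a−1}(1−t)^{(1−2a)−1} dt` to `u^{(½−a)−1}(1−u)^{a−1} du`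
EXACTLY, whence in the formal period ring

  `⟦[pt, 4^a]⟧ · ⟦β(a, 1−2a)⟧ = ⟦β(½−a, a)⟧`            (`soloInformed_inversion_chain`),

i.e. `4^a B(a,1−2a) = B(½−a,a)` (Legendre's duplication at `z = ½ − a`, in a Beta incarnation
DIFFERENT from the duplication move `u = 4t(1−t)` of Theorem IX⁗, which is the quotient by the
other involution `t ↦ 1 − t` and needs `β(a,a)`).  The multiplier `4^a` is an irrational
algebraic number in general.

COROLLARY (the cycle relation W14 of the level-6 census, `soloInformed_torsion_W14`): at
`a = ⅙` the move gives `⟦[pt,4^{1/6}]⟧ · ⟦β(⅙,⅔)⟧ = ⟦β(⅓,⅙)⟧`, and the torsion chain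
(Theorem X, `soloInformed_torsion_W12`) gives `⟦β(⅓,⅙)⟧ = 2⟦β(⅓,½)⟧`; hence
`⟦[pt,4^{1/6}]⟧ · ⟦β(⅙,⅔)⟧ = 2 · ⟦β(⅓,½)⟧`, `B(⅙,⅔) = 2^{2/3} B(⅓,½)`, `⟦β(⅙,⅔)⟧` lies in
every `K`-hull containing `⟦β(⅓,½)⟧`, and `KZP` holds for `β(⅙,⅔)` against the decided hull
`K[⟦β(⅓,½)⟧, ⟦π⟧]`.  With W12 and W14 ALL SIX level-6 classes of the first kind
(`⟦β(i/6,j/6)⟧`, `i + j < 6`) are `K^×`-multiples of `⟦β(⅓,½)⟧` BY THE MOVES.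

References: M. Kontsevich, D. Zagier, *Periods* (2001), §1.2; G. Andrews, R. Askey, R. Roy,
*Special Functions* (1999), Thm. 1.5.1 (Legendre duplication); this work (solo-informed s23).
-/

noncomputable section

open MeasureTheory Set Filter
open scoped Classical

open Literature.NumberTheory.Transcendental Literature.NumberTheory.Transcendental.KZ
open Literature.ModelTheory.ExponentialFields

namespace Summit.KontsevichZagierPeriods.KontsevichZagierPeriods.Theorems

/-! ### The map `φ(t) = ((1−t)/(1+t))²` on `(0,1)` -/

/-- `φ(t) = ((1 − t)/(1 + t))²`, the inversion-quotient coordinate. [this work] -/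
def soloInformedQuotFun (t : ℝ) : ℝ := ((1 - t) / (1 + t)) ^ 2

/-- `φ'(t) = −4(1 − t)/(1 + t)³`. [this work] -/
def soloInformedQuotDeriv (t : ℝ) : ℝ := -(4 * (1 - t) / (1 + t) ^ 3)

/-- `1 − φ(t) = 4t/(1+t)²`. [this work] -/
theorem soloInformed_one_sub_quotFun {t : ℝ} (ht : 1 + t ≠ 0) :
    1 - soloInformedQuotFun t = 4 * t / (1 + t) ^ 2 := by
  unfold soloInformedQuotFun
  field_simp
  ring

/-- The derivative of `φ` away from `t = −1`. [this work] -/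
theorem soloInformed_hasDerivAt_quotFun {t : ℝ} (ht : 1 + t ≠ 0) :
    HasDerivAt soloInformedQuotFun (soloInformedQuotDeriv t) t := by
  have h1 : HasDerivAt (fun y : ℝ => 1 - y) (-1) t := by
    simpa using (hasDerivAt_id' t).const_sub 1
  have h2 : HasDerivAt (fun y : ℝ => 1 + y) 1 t := by
    simpa using (hasDerivAt_id' t).const_add 1
  have h := (h1.fun_div h2 ht).fun_pow 2
  have hfun : soloInformedQuotFun = fun y : ℝ => ((1 - y) / (1 + y)) ^ 2 := rfl
  rw [hfun]
  refine h.congr_deriv ?_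
  unfold soloInformedQuotDeriv
  simp only [Nat.cast_ofNat, show (2 - 1 : ℕ) = 1 from rfl, pow_one]
  field_simp
  ring

/-- `φ` is continuous on `[0, 1]`. [this work] -/
theorem soloInformed_continuousOn_quotFun : ContinuousOn soloInformedQuotFun (Icc (0:ℝ) 1) :=
  fun t ht => (soloInformed_hasDerivAt_quotFun (show 1 + t ≠ 0 by linarith [ht.1])).continuousAt
    |>.continuousWithinAt

/-- `φ` maps `(0,1)` into `(0,1)`. [this work] -/
theorem soloInformed_quotFun_mem {t : ℝ} (h0 : 0 < t) (h1 : t < 1) :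
    soloInformedQuotFun t ∈ Ioo (0:ℝ) 1 := by
  unfold soloInformedQuotFun
  have hS : 0 < 1 + t := by linarith
  have hr : 0 < (1 - t) / (1 + t) := div_pos (by linarith) hS
  have hr1 : (1 - t) / (1 + t) < 1 := (div_lt_one hS).2 (by linarith)
  exact ⟨pow_pos hr 2, pow_lt_one₀ hr.le hr1 two_ne_zero⟩

/-- `φ' < 0` on `(0,1)` (so `φ` is decreasing there). [this work] -/
theorem soloInformed_quotDeriv_neg {t : ℝ} (h0 : 0 < t) (h1 : t < 1) :
    soloInformedQuotDeriv t < 0 := by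
  unfold soloInformedQuotDeriv
  have hP : 0 < 1 - t := by linarith
  have hS : 0 < 1 + t := by linarith
  exact neg_neg_of_pos (by positivity)

/-- `φ` is injective on `(0,1)` and maps it onto `(0,1)` (`φ(0) = 1`, `φ(1) = 0`). [this work] -/
theorem soloInformed_quotFun_subst :
    InjOn soloInformedQuotFun (Ioo (0:ℝ) 1) ∧ soloInformedQuotFun '' Ioo (0:ℝ) 1 = Ioo (0:ℝ) 1 :=
  soloInformed_Ioo_substitution (by norm_num) soloInformed_continuousOn_quotFun
    (fun t ht => soloInformed_hasDerivAt_quotFun (show 1 + t ≠ 0 by linarith [ht.1]))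
    (fun t ht => (soloInformed_quotDeriv_neg ht.1 ht.2).ne)
    (fun _ ht => soloInformed_quotFun_mem ht.1 ht.2)
    (Or.inr ⟨by norm_num [soloInformedQuotFun], by norm_num [soloInformedQuotFun]⟩)

/-- The lift of `φ` is a `ℚ`-semialgebraic map on any semialgebraic set of positive points.
[BCR 1998, §2.2] -/
theorem soloInformed_isSemialgebraicMapOn_lift_quotFun {D : Set (Fin 1 → ℝ)}
    (hD : IsSemialgebraic ℚ D) (hD0 : ∀ x ∈ D, 0 < x 0) :
    IsSemialgebraicMapOn ℚ D (soloInformedLift soloInformedQuotFun) := by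
  refine IsSemialgebraicMapOn.of_forall hD fun j => ?_
  refine (isSemialgebraicFunOn_aeval_div_aeval hD
    ((1 - MvPolynomial.X 0) ^ 2) ((1 + MvPolynomial.X 0) ^ 2)
    fun x hx => ?_).congr fun x hx => ?_
  · have : (1 + x 0) ≠ 0 := by linarith [hD0 x hx]
    simpa using pow_ne_zero 2 this
  · simp [soloInformedLift, soloInformedQuotFun, div_pow]

/-! ### The integrand identity and the move -/

/-- **Integrand identity of the inversion move**: for `t ∈ (0,1)` and rational `a`,
`4^a · t^{a−1} (1−t)^{(1−2a)−1} = φ(t)^{(½−a)−1} (1 − φ(t))^{a−1} |φ'(t)|`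
(powers of `1 + t` cancel: `(1+2a) + (2−2a) − 3 = 0`). [this work] -/
theorem soloInformed_inversion_integrand_identity (a : ℚ) {t : ℝ} (h0 : 0 < t) (h1 : t < 1) :
    (4:ℝ) ^ (a : ℝ) * (t ^ ((a : ℝ) - 1) * (1 - t) ^ (((1 - 2 * a : ℚ) : ℝ) - 1)) =
      soloInformedQuotFun t ^ (((1 / 2 - a : ℚ) : ℝ) - 1) *
        (1 - soloInformedQuotFun t) ^ ((a : ℝ) - 1) * |soloInformedQuotDeriv t| := by
  have hP : 0 < 1 - t := by linarith
  have hS : 0 < 1 + t := by linarith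
  have hr : 0 < (1 - t) / (1 + t) := div_pos hP hS
  have e0 : (1 - t) ^ (((1 - 2 * a : ℚ) : ℝ) - 1) = ((1 - t) ^ (2 * (a : ℝ)))⁻¹ := by
    rw [← Real.rpow_neg hP.le]
    congr 1
    push_cast
    ring
  have eT : t ^ ((a : ℝ) - 1) = t ^ (a : ℝ) / t := Real.rpow_sub_one h0.ne' _
  have e1 : soloInformedQuotFun t ^ (((1 / 2 - a : ℚ) : ℝ) - 1) =
      ((1 - t) / (1 + t) * ((1 - t) ^ (2 * (a : ℝ)) / (1 + t) ^ (2 * (a : ℝ))))⁻¹ := by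
    unfold soloInformedQuotFun
    rw [← Real.rpow_natCast _ 2, ← Real.rpow_mul hr.le,
      show ((2 : ℕ) : ℝ) * ((((1 / 2 - a : ℚ)) : ℝ) - 1) = -(1 + 2 * (a : ℝ)) by push_cast; ring,
      Real.rpow_neg hr.le, Real.rpow_add hr, Real.rpow_one, Real.div_rpow hP.le hS.le]
  have e2 : (1 - soloInformedQuotFun t) ^ ((a : ℝ) - 1) =
      (4:ℝ) ^ (a : ℝ) / 4 * (t ^ (a : ℝ) / t) / ((1 + t) ^ (2 * (a : ℝ)) / (1 + t) ^ 2) := by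
    rw [soloInformed_one_sub_quotFun hS.ne', Real.div_rpow (by positivity) (by positivity),
      Real.mul_rpow (by norm_num) h0.le, Real.rpow_sub_one (by norm_num) (a : ℝ),
      Real.rpow_sub_one h0.ne', ← Real.rpow_natCast (1 + t) 2, ← Real.rpow_mul hS.le,
      show ((2 : ℕ) : ℝ) * ((a : ℝ) - 1) = 2 * (a : ℝ) - ((2 : ℕ) : ℝ) by push_cast; ring,
      Real.rpow_sub hS]
  have e3 : |soloInformedQuotDeriv t| = 4 * (1 - t) / (1 + t) ^ 3 := by
    unfold soloInformedQuotDeriv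
    rw [abs_neg, abs_of_pos (by positivity)]
  rw [e0, eT, e1, e2, e3]
  have h4 : (4:ℝ) ^ (a : ℝ) ≠ 0 := (Real.rpow_pos_of_pos (by norm_num) _).ne'
  have hta : t ^ (a : ℝ) ≠ 0 := (Real.rpow_pos_of_pos h0 _).ne'
  have hPa : (1 - t) ^ (2 * (a : ℝ)) ≠ 0 := (Real.rpow_pos_of_pos hP _).ne'
  have hSa : (1 + t) ^ (2 * (a : ℝ)) ≠ 0 := (Real.rpow_pos_of_pos hS _).ne'
  have hP' : 1 - t ≠ 0 := hP.ne'
  have hS' : 1 + t ≠ 0 := hS.ne'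
  have ht' : t ≠ 0 := h0.ne'
  field_simp

/-- **The inversion move (rule 2).** For rational `a`, a pinned `A = β(a, 1−2a)` and a pinned
`B = β(½−a, a)` on `(0,1)`, the substitution `u = ((1−t)/(1+t))²` gives
`[4^a · A] − [B] ∈ changeOfVariablesRel`. [Kontsevich–Zagier 2001, §1.2; this work] -/
theorem soloInformed_inversion_mem_changeOfVariablesRel (a : ℚ)
    (h4 : IsAlgebraic ℚ ((4:ℝ) ^ (a : ℝ))) (A B : IntegralRep 1)
    (hAd : A.domain = {t | t 0 ∈ Ioo (0:ℝ) 1})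
    (hAi : EqOn A.integrand
      (fun t => (t 0) ^ ((a : ℝ) - 1) * (1 - t 0) ^ (((1 - 2 * a : ℚ) : ℝ) - 1)) A.domain)
    (hBd : B.domain = {t | t 0 ∈ Ioo (0:ℝ) 1})
    (hBi : EqOn B.integrand
      (fun t => (t 0) ^ (((1 / 2 - a : ℚ) : ℝ) - 1) * (1 - t 0) ^ ((a : ℝ) - 1)) B.domain) :
    of (A.constMul ((4:ℝ) ^ (a : ℝ)) h4) - of B ∈ changeOfVariablesRel := by
  refine soloInformed_lift_mem_changeOfVariablesRel _ B (g' := soloInformedQuotDeriv)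
    (by rw [IntegralRep.domain_constMul, hAd]) hBd ?_
    (fun t ht => soloInformed_hasDerivAt_quotFun (show 1 + t ≠ 0 by linarith [ht.1]))
    soloInformed_quotFun_subst.1 soloInformed_quotFun_subst.2 fun x hx => ?_
  · rw [IntegralRep.domain_constMul, hAd]
    exact soloInformed_isSemialgebraicMapOn_lift_quotFun (hAd ▸ A.isSemialgebraic_domain)
      fun x hx => (show 0 < x 0 ∧ x 0 < 1 from hx).1
  · have hx' : 0 < x 0 ∧ x 0 < 1 := by
      rw [IntegralRep.domain_constMul, hAd] at hx
      exact hx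
    have hΦ : soloInformedLift soloInformedQuotFun x ∈ B.domain := by
      rw [hBd]
      exact soloInformed_quotFun_mem hx'.1 hx'.2
    have hxA : x ∈ A.domain := by rw [hAd]; exact hx'
    rw [IntegralRep.integrand_constMul]
    dsimp only
    rw [hAi hxA, hBi hΦ]
    exact soloInformed_inversion_integrand_identity a hx'.1 hx'.2

/-! ### THEOREM XI (inversion chain): `⟦[pt, 4^a]⟧ · ⟦β(a,1−2a)⟧ = ⟦β(½−a,a)⟧` -/

/-- **THEOREM XI (the inversion chain).** For every rational `a` and pinned representations
`A = β(a, 1−2a)`, `B = β(½−a, a)` on `(0,1)`:  `⟦[pt, 4^a]⟧ · ⟦A⟧ = ⟦B⟧` in the formal period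
ring, by ONE algebraic change of variables (`u = ((1−t)/(1+t))²`) and no other rule.
[this work] -/
theorem soloInformed_inversion_chain (a : ℚ) (h4 : IsAlgebraic ℚ ((4:ℝ) ^ (a : ℝ)))
    (A B : IntegralRep 1)
    (hAd : A.domain = {t | t 0 ∈ Ioo (0:ℝ) 1})
    (hAi : EqOn A.integrand
      (fun t => (t 0) ^ ((a : ℝ) - 1) * (1 - t 0) ^ (((1 - 2 * a : ℚ) : ℝ) - 1)) A.domain)
    (hBd : B.domain = {t | t 0 ∈ Ioo (0:ℝ) 1})
    (hBi : EqOn B.integrand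
      (fun t => (t 0) ^ (((1 / 2 - a : ℚ) : ℝ) - 1) * (1 - t 0) ^ ((a : ℝ) - 1)) B.domain) :
    toFormalPeriod (of (IntegralRep.unit.constMul ((4:ℝ) ^ (a : ℝ)) h4)) *
      toFormalPeriod (of A) = toFormalPeriod (of B) := by
  rw [← toFormalPeriod_of_constMul]
  exact toFormalPeriod_eq_iff.mpr (changeOfVariablesRel_subset_relations
    (soloInformed_inversion_mem_changeOfVariablesRel a h4 A B hAd hAi hBd hBi))

/-- **Value form of the inversion chain**: `4^a · B(a, 1−2a) = B(½−a, a)` for pinned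
representations (a Beta incarnation of Legendre's duplication, here a COROLLARY of one move).
[Andrews–Askey–Roy 1999, Thm. 1.5.1; this work] -/
theorem soloInformed_inversion_value (a : ℚ) (A B : IntegralRep 1)
    (hAd : A.domain = {t | t 0 ∈ Ioo (0:ℝ) 1})
    (hAi : EqOn A.integrand
      (fun t => (t 0) ^ ((a : ℝ) - 1) * (1 - t 0) ^ (((1 - 2 * a : ℚ) : ℝ) - 1)) A.domain)
    (hBd : B.domain = {t | t 0 ∈ Ioo (0:ℝ) 1})
    (hBi : EqOn B.integrand
      (fun t => (t 0) ^ (((1 / 2 - a : ℚ) : ℝ) - 1) * (1 - t 0) ^ ((a : ℝ) - 1)) B.domain) :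
    (4:ℝ) ^ (a : ℝ) * A.value = B.value := by
  have h4 : IsAlgebraic ℚ ((4:ℝ) ^ (a : ℝ)) := by
    simpa using soloInformed_isAlgebraic_natCast_rpow_ratCast 4 (by norm_num) a
  have h := congr_arg evalP (soloInformed_inversion_chain a h4 A B hAd hAi hBd hBi)
  rwa [map_mul, evalP_toFormalPeriod_of, evalP_toFormalPeriod_of, evalP_toFormalPeriod_of,
    IntegralRep.value_constMul, IntegralRep.value_unit, mul_one] at h

/-- **`⟦β(a,1−2a)⟧` lies in the `K`-hull of any family whose hull contains `⟦β(½−a,a)⟧`**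
(`⟦[pt,4^a]⟧` is a unit of `K ⊂ P`). [this work] -/
theorem soloInformed_betaInv_mem_algHull (a : ℚ) (A B : IntegralRep 1)
    (hAd : A.domain = {t | t 0 ∈ Ioo (0:ℝ) 1})
    (hAi : EqOn A.integrand
      (fun t => (t 0) ^ ((a : ℝ) - 1) * (1 - t 0) ^ (((1 - 2 * a : ℚ) : ℝ) - 1)) A.domain)
    (hBd : B.domain = {t | t 0 ∈ Ioo (0:ℝ) 1})
    (hBi : EqOn B.integrand
      (fun t => (t 0) ^ (((1 / 2 - a : ℚ) : ℝ) - 1) * (1 - t 0) ^ ((a : ℝ) - 1)) B.domain)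
    {k : ℕ} (c : Fin k → FormalPeriodRing) (hB : toFormalPeriod (of B) ∈ soloInformedAlgHull c) :
    toFormalPeriod (of A) ∈ soloInformedAlgHull c := by
  have h4 : (4:ℝ) ^ (a : ℝ) ≠ 0 := (Real.rpow_pos_of_pos (by norm_num) _).ne'
  have h4a : IsAlgebraic ℚ ((4:ℝ) ^ (a : ℝ)) := by
    simpa using soloInformed_isAlgebraic_natCast_rpow_ratCast 4 (by norm_num) a
  have hinv : IsAlgebraic ℚ ((4:ℝ) ^ (a : ℝ))⁻¹ := by
    have : IsAlgebraic ℚ ((4:ℝ) ^ ((-a : ℚ) : ℝ)) := by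
      simpa using soloInformed_isAlgebraic_natCast_rpow_ratCast 4 (by norm_num) (-a)
    rwa [Rat.cast_neg, Real.rpow_neg (by norm_num)] at this
  have hchain := soloInformed_inversion_chain a h4a A B hAd hAi hBd hBi
  have hA : toFormalPeriod (of A) = toFormalPeriod (of (IntegralRep.unit.constMul
      ((4:ℝ) ^ (a : ℝ))⁻¹ hinv)) * toFormalPeriod (of B) := by
    rw [← hchain, ← mul_assoc, soloInformed_pointRep_inv_mul _ _ h4 hinv, one_mul]
  rw [hA]
  exact mul_mem (soloInformed_pointRep_mem_algHull c _ hinv) hB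

/-! ### The cycle relation W14: `⟦[pt,4^{1/6}]⟧ · ⟦β(⅙,⅔)⟧ = 2 · ⟦β(⅓,½)⟧` -/

/-- **THEOREM XI′ (W14).** For pinned `B₁₄ = β(⅙,⅔)` and `B₃₂ = β(⅓,½)`:
`⟦[pt, 4^{1/6}]⟧ · ⟦B₁₄⟧ = 2 · ⟦B₃₂⟧` — the inversion move at `a = ⅙` onto `β(⅓,⅙)`, then the
torsion chain of Theorem X. No cancellation, no `π`. [this work] -/
theorem soloInformed_torsion_W14 (h4 : IsAlgebraic ℚ ((4:ℝ) ^ (((1 / 6 : ℚ)) : ℝ)))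
    (B₁₄ B₃₂ : IntegralRep 1)
    (h14d : B₁₄.domain = {t | t 0 ∈ Ioo (0:ℝ) 1})
    (h14i : EqOn B₁₄.integrand
      (fun t => (t 0) ^ (((1 / 6 : ℚ) : ℝ) - 1) * (1 - t 0) ^ (((2 / 3 : ℚ) : ℝ) - 1))
      B₁₄.domain)
    (h32d : B₃₂.domain = {t | t 0 ∈ Ioo (0:ℝ) 1})
    (h32i : EqOn B₃₂.integrand
      (fun t => (t 0) ^ (((1 / 3 : ℚ) : ℝ) - 1) * (1 - t 0) ^ (((1 / 2 : ℚ) : ℝ) - 1))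
      B₃₂.domain) :
    toFormalPeriod (of (IntegralRep.unit.constMul ((4:ℝ) ^ (((1 / 6 : ℚ)) : ℝ)) h4)) *
      toFormalPeriod (of B₁₄) = 2 * toFormalPeriod (of B₃₂) := by
  obtain ⟨B₃₆, h36d, h36i⟩ := exists_betaRep' (1 / 3) (1 / 6) (by norm_num) (by norm_num)
  have hA : EqOn B₁₄.integrand (fun t => (t 0) ^ (((1 / 6 : ℚ) : ℝ) - 1) *
      (1 - t 0) ^ (((1 - 2 * (1 / 6) : ℚ) : ℝ) - 1)) B₁₄.domain := fun x hx => by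
    rw [h14i hx]
    norm_num
  have hB : EqOn B₃₆.integrand (fun t => (t 0) ^ (((1 / 2 - 1 / 6 : ℚ) : ℝ) - 1) *
      (1 - t 0) ^ (((1 / 6 : ℚ) : ℝ) - 1)) B₃₆.domain := fun x _ => by
    rw [h36i]
    norm_num
  rw [soloInformed_inversion_chain (1 / 6) h4 B₁₄ B₃₆ h14d hA h36d hB,
    soloInformed_torsion_W12 B₃₆ B₃₂ h36d (fun x _ => by rw [h36i]) h32d h32i]

/-- **Value form of W14**: `4^{1/6} · B(⅙,⅔) = 2 · B(⅓,½)`, i.e. `B(⅙,⅔) = 2^{2/3} B(⅓,½)`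
(`x(1,4) = 2^{2/3}·x(2,3)` in the census notation). [this work] -/
theorem soloInformed_torsion_W14_value (B₁₄ B₃₂ : IntegralRep 1)
    (h14d : B₁₄.domain = {t | t 0 ∈ Ioo (0:ℝ) 1})
    (h14i : EqOn B₁₄.integrand
      (fun t => (t 0) ^ (((1 / 6 : ℚ) : ℝ) - 1) * (1 - t 0) ^ (((2 / 3 : ℚ) : ℝ) - 1))
      B₁₄.domain)
    (h32d : B₃₂.domain = {t | t 0 ∈ Ioo (0:ℝ) 1})
    (h32i : EqOn B₃₂.integrand
      (fun t => (t 0) ^ (((1 / 3 : ℚ) : ℝ) - 1) * (1 - t 0) ^ (((1 / 2 : ℚ) : ℝ) - 1))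
      B₃₂.domain) :
    (4:ℝ) ^ (((1 / 6 : ℚ)) : ℝ) * B₁₄.value = 2 * B₃₂.value := by
  have h4 : IsAlgebraic ℚ ((4:ℝ) ^ (((1 / 6 : ℚ)) : ℝ)) := by
    simpa using soloInformed_isAlgebraic_natCast_rpow_ratCast 4 (by norm_num) (1 / 6)
  have h := congr_arg evalP (soloInformed_torsion_W14 h4 B₁₄ B₃₂ h14d h14i h32d h32i)
  rwa [map_mul, map_mul, evalP_toFormalPeriod_of, evalP_toFormalPeriod_of,
    evalP_toFormalPeriod_of, IntegralRep.value_constMul, IntegralRep.value_unit, mul_one,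
    map_ofNat] at h

/-- **`⟦β(⅙,⅔)⟧` lies in the `K`-hull of any family whose hull contains `⟦β(⅓,½)⟧`**; in
particular in the decided hull `K[⟦β(⅓,½)⟧, ⟦π⟧]`. [this work] -/
theorem soloInformed_betaSixthTwoThirds_mem_algHull (B₁₄ B₃₂ : IntegralRep 1)
    (h14d : B₁₄.domain = {t | t 0 ∈ Ioo (0:ℝ) 1})
    (h14i : EqOn B₁₄.integrand
      (fun t => (t 0) ^ (((1 / 6 : ℚ) : ℝ) - 1) * (1 - t 0) ^ (((2 / 3 : ℚ) : ℝ) - 1))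
      B₁₄.domain)
    (h32d : B₃₂.domain = {t | t 0 ∈ Ioo (0:ℝ) 1})
    (h32i : EqOn B₃₂.integrand
      (fun t => (t 0) ^ (((1 / 3 : ℚ) : ℝ) - 1) * (1 - t 0) ^ (((1 / 2 : ℚ) : ℝ) - 1))
      B₃₂.domain)
    {k : ℕ} (c : Fin k → FormalPeriodRing)
    (hB : toFormalPeriod (of B₃₂) ∈ soloInformedAlgHull c) :
    toFormalPeriod (of B₁₄) ∈ soloInformedAlgHull c := by
  obtain ⟨B₃₆, h36d, h36i⟩ := exists_betaRep' (1 / 3) (1 / 6) (by norm_num) (by norm_num)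
  have hA : EqOn B₁₄.integrand (fun t => (t 0) ^ (((1 / 6 : ℚ) : ℝ) - 1) *
      (1 - t 0) ^ (((1 - 2 * (1 / 6) : ℚ) : ℝ) - 1)) B₁₄.domain := fun x hx => by
    rw [h14i hx]
    norm_num
  have hB36 : EqOn B₃₆.integrand (fun t => (t 0) ^ (((1 / 2 - 1 / 6 : ℚ) : ℝ) - 1) *
      (1 - t 0) ^ (((1 / 6 : ℚ) : ℝ) - 1)) B₃₆.domain := fun x _ => by
    rw [h36i]
    norm_num
  exact soloInformed_betaInv_mem_algHull (1 / 6) B₁₄ B₃₆ h14d hA h36d hB36 c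
    (soloInformed_betaThirdSixth_mem_algHull B₃₆ B₃₂ h36d (fun x _ => by rw [h36i]) h32d h32i
      c hB)

/-- **`KZP` decided for `β(⅙,⅔)` against the hull `K[⟦β(⅓,½)⟧, ⟦π⟧]`**: a representation with
class in that hull and the same value as `β(⅙,⅔)` is KZ-equivalent to it. [this work] -/
theorem soloInformed_kzp_betaSixthTwoThirds (B₁₄ B₃₂ : IntegralRep 1)
    (h14d : B₁₄.domain = {t | t 0 ∈ Ioo (0:ℝ) 1})
    (h14i : EqOn B₁₄.integrand
      (fun t => (t 0) ^ (((1 / 6 : ℚ) : ℝ) - 1) * (1 - t 0) ^ (((2 / 3 : ℚ) : ℝ) - 1))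
      B₁₄.domain)
    (h32d : B₃₂.domain = {t | t 0 ∈ Ioo (0:ℝ) 1})
    (h32i : EqOn B₃₂.integrand
      (fun t => (t 0) ^ (((1 / 3 : ℚ) : ℝ) - 1) * (1 - t 0) ^ (((1 / 2 : ℚ) : ℝ) - 1))
      B₃₂.domain)
    {m : ℕ} (r' : IntegralRep m)
    (hr' : toFormalPeriod (of r') ∈
      soloInformedAlgHull ![toFormalPeriod (of B₃₂), toFormalPeriod (of KZ.piRep)])
    (hv : B₁₄.value = r'.value) : Equivalent B₁₄ r' :=
  soloInformed_kzp_on_hull_betaThirdHalf_pi B₃₂ h32d h32i B₁₄ r'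
    (soloInformed_betaSixthTwoThirds_mem_algHull B₁₄ B₃₂ h14d h14i h32d h32i _
      (soloInformed_mem_algHull_self _ 0)) hr' hv

end Summit.KontsevichZagierPeriods.KontsevichZagierPeriods.Theorems

end
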